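import Summits.AtomisticToContinuum.BoseEinsteinCondensation.Theses.BECInsertionCorrector
import Summits.AtomisticToContinuum.BoseEinsteinCondensation.Theorems.CorrectorClosure.Negative.InsertionResidueLoadBearing
import Literature.MathematicalPhysics.QuantumManyBody.PeriodicHeatFlowSpectral
import Literature.MathematicalPhysics.QuantumManyBody.WeightedCorrector
import HarnessLib.Audit

/-!
# Line `healing-scale-kac-insertion` — skeleton v3 for crux `BECInsertionCorrector.CorrectorClosure`
(item stmt-AtomisticToContinuum-12058, route route-AtomisticToContinuum-BECInsertionCorrector;
second line lead prover-line-stmt-AtomisticToContinuum-12058-b-0, 2026-08-16; v1/v2 by the crux-plan seat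
planner-cruxplan-stmt-AtomisticToContinuum-12058-healing-scale-kac-in-0, 2026-08-15)

Crux (fixed, by name): `CorrectorClosure := StaticResponseBound → InsertionResidue`.

Idea (card `Cruxes/CorrectorClosure/Ideas/healing-scale-kac-insertion.md`, triage r1-1/2/3: pass ×3):
mollify the insertion amplitude `h = Φ₀/Θ₀` (ratio of the `(N+1)`- and `N`-body torus FK ground states) in
the TAGGED coordinate only, at the healing time `t⋆ = (N+1)/(16 E₀(N+1,L)) ≍ ξ²` (Gaussian kernel
`G_t(z) = (4πt)^{-3/2} e^{-|z|²/4t}`): the insertion overlap is unchanged, the smoothed mass is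
`B ≥ e^{-1/8} ≥ 9/16` (`stub_uvTransfer`, every measurable `v`), the Kipnis–Varadhan engine for the Kac
operator `K₀ + U_t` fed with K1 in `H₋₁` currency (`stub_responseDictionary`) and the recoil lemma
(`stub_firstCorrector`) bounds the mollified residue `Z_{t⋆} = A/B ≥ cK` (`stub_kacClosure`, HARDEST, held
by the lead), and the fixed-`N` spectral frame (`stub_groundStateExists`, `stub_nearMinimiserRigidity`)
moves `A ≥ (9/16)cK` into the crux's `∃ δ ∃ Θ ∀ Ψ` frame.

## Reshape v3 (lead, 2026-08-16) — what changed against v2 and why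

* The torus Feynman–Kac frame (`IsPeriodicGroundStateFK`, continuity, positivity, small-time form
  bounds, compactness, Perron–Frobenius, spectral measure) exists in the tree for BOUNDED periodised
  potentials only (`PeriodicGroundStateFeynmanKac` — named fact, support files `PeriodicFeynmanKac*.lean`
  landed, `_holds` pending; `PeriodicHeatFlowSpectralMeasure_holds` proved). v2 typed stubs 2–5 for every
  admissible `v` "given FK ground states", which no worker can prove for hard cores. v3 threads
  boundedness EXPLICITLY: `stub_groundStateExists` (bounded `v` ⇒ bounded `v^per` in the box, FK ground
  states of `N` and `N+1` bodies exist, are continuous and positive, eventually in `N`), and stubs 3–6 carry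
  `hb : ∃ C, ∀ x, v^per x ≤ C`. The composition splits on `∃ C, ∀ r, v r ≤ C`; the unbounded
  (hard / singular core) case is ISOLATED as `stub_unboundedCase` — crux-sized, undelegated, the honest
  hole of this line (and of `residue-area-law`): it needs either hard-core FK technology or a truncation
  argument with constants uniform in the cut-off, neither available.
* v2's `stub_groundStateFrame` is split into existence (`stub_groundStateExists`) and rigidity
  (`stub_nearMinimiserRigidity`), both fixed-`N`, K1-free.
* v2's 40-line `let`-tower signatures (Gaussian, Kac potential `U`, mark functional `ℓ`) are gone: the
  dressed-charge / marks lemma (v2 `stub_dressedCharge`, the triage sharpening) becomes an INTERNAL step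
  of the heart `stub_kacClosure`, whose docstring keeps its typed form for the disprover; the heart's
  hypotheses are now only tree-vocabulary statements (FK data, the `H₋₁` dictionary output, the recoil
  lemma) and its conclusion `cK · B ≤ A` has the single `let T` of `stub_uvTransfer`.
* NEW `stub_firstCorrector` — the recoil lemma `(ω + q)⁻² ≤ (4ωq)⁻¹` in the tree's weighted-corrector
  vocabulary: a weak solution `ξ` of `(-G_Θ + q) ξ = a` has `4q ∫ ξ²Θ² ≤ ‖a‖²_{H₋₁(G_Θ)}` (the first
  brick of the route's FirstCorrectorBounds; consumed by the heart as a hypothesis).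
* `stub_uvTransfer` unchanged in signature; NEW PROOF PLAN without any kinetic energy of the FK
  eigenfunction: `B = Σ_P e^{-2T|p₀|²}|ĉ_P|² = Σ_P (AM_j e^{-2T|p_j|²})|ĉ_P|² ≥ Σ_P e^{-2T|P|²/(N+1)}|ĉ_P|²
  = ⟨Φ₀, e^{(2T/(N+1))Δ}Φ₀⟩ ≥ ⟨Φ₀, e^{-(2T/(N+1))H}Φ₀⟩ = e^{-2TE₀/(N+1)} = e^{-1/8}` (Bose symmetry,
  AM–GM, Feynman–Kac domination `e^{-tH} ≤ e^{tΔ}` for `v ≥ 0`, the eigen-relation).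

Stubs (7 = stubs_max): `stub_uvTransfer` (M/L), `stub_groundStateExists` (S given the named fact; blocked on
`PeriodicGroundStateFeynmanKac_holds` otherwise), `stub_nearMinimiserRigidity` (L), `stub_responseDictionary`
(L; consumes `StaticResponseBound` BY NAME), `stub_firstCorrector` (S), `stub_kacClosure` (XL, hardest, lead),
`stub_unboundedCase` (crux-sized hole, undelegated).

Composition `CorrectorClosure_of : CorrectorClosure` (sorry-free glue): `by_cases` on boundedness of `v`;
bounded: thresholds `min ρᵢ`, `c = (9/32)·cK`, eventualities combined with `filter_upwards`, then
`2c = cK·(9/16) ≤ cK·B ≤ A ≤ Res(Θ,Ψ) + c` in `ℝ≥0∞`; unbounded: `stub_unboundedCase`.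

Disproof.lean (gen 3 v9, tree `Cruxes/CorrectorClosure/Disproof.lean`) — obligations, re-read 2026-08-16T03Z:
§1 K1 consumed by name in `stub_responseDictionary` and `stub_unboundedCase`; §3 the window on `Ψ` is used in
`stub_nearMinimiserRigidity` only; §4 `E₀^per < ⊤` enters through `IsPeriodicGroundStateFK.energy_ne_top`
(bounded `v^per` ⇒ finite energy of the constant state); §7 `δ` produced after `N`; §5/§8 `c = 9cK/32 < 1`,
free gas `A = B = 1`; §9 (pitfall for THIS card) honoured: `θ = 1/16 ≤ 1`, constant `9/16`; §10 every stub
has its own `∃ ρᵢ > 0`; §12/§15 target the other lead's line; §13 dimension test lives in the heart only.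
No `-- Targets` theorem names a stub of this line (v9). Negatives index: nothing on insertion/Kac objects.
-/

noncomputable section

open MeasureTheory Filter Matrix
open scoped ENNReal NNReal BigOperators ComplexConjugate

namespace Summit.AtomisticToContinuum.BoseEinsteinCondensation.Cruxes.CorrectorClosure.HealingScaleKacInsertion

open Literature.MathematicalPhysics.QuantumManyBody.BoseGas
open Summit.AtomisticToContinuum.BoseEinsteinCondensation.Theses.BECInsertionCorrector
open Summit.AtomisticToContinuum.BoseEinsteinCondensation.Theorems.CorrectorClosure.Negative
  (sideLength_succ_pos)

set_option linter.unusedVariables false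

/-! ## Stubs (the seven open lemmas of the line; `sorry` only here) -/

/-- **Stub 1 — UV transfer (the residue does not see the tagged ultraviolet).**
For the `(N+1)`-body torus FK ground state `Φ₀ = periodicFKGroundState v (N+1) L` and the healing time
`T = (N+1)/(16 E₀(N+1,L))`, the Gaussian smoothing `e^{TΔ₀}` IN THE TAGGED COORDINATE ONLY keeps at least
`9/16` of the mass: `B = ∫_{cell^{N+1}} (e^{TΔ₀}Φ₀)² ≥ 9/16`.
Proof plan (v3, no kinetic energy of the eigenfunction needed): with `ĉ_P`, `P = (p₀,…,p_N) ∈ (2π/L)ℤ^{3(N+1)}`,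
the Fourier coefficients of `Φ₀ ∈ L²(cell)` (`Σ|ĉ_P|² = 1` after normalising Parseval),
(i) `ĉ_P(e^{TΔ₀}Φ₀) = e^{-T|p₀|²} ĉ_P(Φ₀)` (the smoothing is the average of translates in `y` under the
Gaussian `N(0, 2T)`, translation rule `configFourierCoeff_translate`, characteristic function of the Gaussian),
so `B = L^{3(N+1)} Σ_P e^{-2T|p₀|²}|ĉ_P|²`; (ii) Bose symmetry of `Φ₀` ⇒ `|ĉ_P|²` is symmetric in the
components of `P`, so `B = L^{3(N+1)} Σ_P (1/(N+1)) Σ_j e^{-2T|p_j|²} |ĉ_P|² ≥ L^{3(N+1)} Σ_P e^{-2T|P|²/(N+1)}|ĉ_P|²`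
(AM–GM = convexity of `exp`, `ConvexOn.map_sum_le`); (iii) the right side is
`⟨Φ₀, e^{sΔ}Φ₀⟩_cell` at `s = 2T/(N+1)` (free torus heat semigroup = `periodicFKSemigroup 0 L s` =
Gaussian average of translates in all coordinates, same translation rule), and Feynman–Kac domination
(`periodicFKWeight ≤ 1` for `v ≥ 0`) gives `⟨Φ₀, e^{sΔ}Φ₀⟩ ≥ ⟨Φ₀, e^{-sH}Φ₀⟩ = e^{-sE₀}` by `hΦ.eigen`
and `hΦ.norm_eq`; (iv) `sE₀ = 1/8`, `e^{-1/8} ≥ 7/8 ≥ 9/16`. Degenerate branch `T ≤ 0` (`E₀.toReal = 0`,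
free gas or junk): the smoothing is the identity and `B = 1`.
Holds for EVERY measurable `v` (hard cores included). Size M/L. Leans on: `IsPeriodicGroundStateFK`
(`eigen`, `norm_eq`, `symm`, `periodic`, `measurable`, `nonneg`), `periodicFKSemigroup`,
`periodicFKWeight`/`periodicPathAction` (domination), `configFourierCoeff`, `hasSum_sq_configFourierCoeff`
(continuous data; for `L²` data transport Mathlib `UnitAddTorus.hasSum_sq_mFourierCoeff`),
`configFourierCoeff_translate`, Mathlib Gaussian integrals / `charFun` of the Gaussian. -/
theorem stub_uvTransfer (v : ℝ → ℝ≥0∞) (hv : Measurable v) (N : ℕ) (L : ℝ) (hL : 0 < L)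
    (hΦ : IsPeriodicGroundStateFK v L (periodicFKGroundState v (N + 1) L)) :
    ENNReal.ofReal (9 / 16) ≤
      ∫⁻ X in cellN (N + 1) L, ENNReal.ofReal
        ((let T : ℝ := ((N : ℝ) + 1) / (16 * (periodicGroundStateEnergy v (N + 1) L).toReal)
          if T ≤ 0 then periodicFKGroundState v (N + 1) L X
          else ∫ z : Space, ((4 * Real.pi * T) ^ (3 / 2 : ℝ))⁻¹ * Real.exp (-‖z‖ ^ 2 / (4 * T)) *
            periodicFKGroundState v (N + 1) L (vecCons (X 0 - z) (vecTail X))) ^ 2) := by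
  sorry

/-- **Stub 2 — existence of the torus FK ground states at low density (bounded potentials).**
For a BOUNDED repulsive finite-range `v` (`v ≤ C`) there is `ρ₀ > 0` such that for `0 < ρ < ρ₀` and all
large `N`, in the box `L = ((N+1)/ρ)^{1/3}`: the periodised potential is bounded (finite range `R₀` and
`L > 2R₀`: at most one lattice image is within range, so `v^per ≤ C`; any `N`-dependent bound suffices),
and the `N`- and `(N+1)`-body torus Hamiltonians have Feynman–Kac ground states
(`IsPeriodicGroundStateFK` for the canonical `periodicFKGroundState`), continuous and strictly positive.
Proof plan: the named fact `PeriodicGroundStateFeynmanKac` (tree: `PeriodicHeatFlowSpectral.lean`; proof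
files `PeriodicFeynmanKac{Cell,Operator,OperatorProps,Symmetry,Compact,PerronFrobenius,FreeForm,EnergyLower,
FormUpper,TrialState}.lean` landed, `PeriodicGroundStateFeynmanKac_holds` PENDING — `lean search` it first)
through `PeriodicGroundStateFeynmanKac.periodicFKGroundState` with `1 ≤ N`, `0 < L`
(`sideLength_succ_pos`), measurability `hv.1`, and the `v^per` bound. If `_holds` is not in the tree the
stub is BLOCKED on it (land the conditional version as a helper). `ρ₀` is not needed for bounded `v`
(any `ρ₀` works); it is kept for uniformity with the other thresholds.
Size S (given the fact). Leans on: `PeriodicGroundStateFeynmanKac` (+ `.periodicFKGroundState`),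
`periodizedPotential`, `latticeVec`, `sideLength_succ_pos`, `tsum_eq_sum`. -/
theorem stub_groundStateExists (v : ℝ → ℝ≥0∞) (hv : IsRepulsiveFiniteRange v)
    (hbdd : ∃ C : ℝ≥0, ∀ r, v r ≤ C) :
    ∃ ρ₀ : ℝ, 0 < ρ₀ ∧ ∀ ρ : ℝ, 0 < ρ → ρ < ρ₀ → ∀ᶠ N : ℕ in atTop,
      (∃ C : ℝ≥0, ∀ x, periodizedPotential v (sideLength ρ (N + 1)) x ≤ C) ∧
      (IsPeriodicGroundStateFK v (sideLength ρ (N + 1)) (periodicFKGroundState v N (sideLength ρ (N + 1))) ∧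
        Continuous (periodicFKGroundState v N (sideLength ρ (N + 1))) ∧
        ∀ X, 0 < periodicFKGroundState v N (sideLength ρ (N + 1)) X) ∧
      (IsPeriodicGroundStateFK v (sideLength ρ (N + 1))
          (periodicFKGroundState v (N + 1) (sideLength ρ (N + 1))) ∧
        Continuous (periodicFKGroundState v (N + 1) (sideLength ρ (N + 1))) ∧
        ∀ X, 0 < periodicFKGroundState v (N + 1) (sideLength ρ (N + 1)) X) := by
  sorry

/-- **Stub 3 — rigidity of near-minimisers at fixed `N` (bounded potentials).**
In a box `L > 0` with bounded `v^per`, if `Θ₀` (`N` bodies) and `Φ₀` (`N+1` bodies) are continuous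
positive FK ground states, then for every `ε > 0` there are `δ > 0` (chosen AFTER `N`, below the
finite-volume gaps — Disproof §3, §7) and a `δ`-near-minimiser `Θ` of the `N`-body energy such that for
EVERY `δ`-near-minimiser `Ψ` of the `(N+1)`-body energy the ground-state residue
`A = L⁻³(∫ Θ₀ ∫_cell Φ₀)²` is at most the crux's overlap `Res(Θ,Ψ) = L⁻³|∫ conj Θ ∫_cell Ψ|²` plus `ε`.
Proof plan: (R1) rigidity for one problem: a `δ`-near-minimiser `Ψ` (complex `C¹`; split into real and
imaginary parts) has spectral measure `μ_Ψ` for the torus flow (`PeriodicHeatFlowSpectralMeasure_holds`)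
with `∫ λ dμ_Ψ ≤ E(Ψ)` (small-time form bound `form_upper_bound_periodic` and monotone convergence of
`(1 - e^{-tλ})/t`), hence Jensen `⟨Ψ, e^{-H}Ψ⟩ = ∫ e^{-λ}dμ_Ψ ≥ e^{-(E₀+δ)}`; on the other hand
`⟨Ψ, e^{-H}Ψ⟩ ≤ f e^{-E₀} + (1 - f) e^{-(E₀+γ)}`, `f = |⟨Φ₀,Ψ⟩|²`, from: `T₁ = pfkL2 v L 1` is compact
self-adjoint positive (`isCompactOperator_pfkL2`, `isSelfAdjoint_pfkL2`), `‖T₁‖ = e^{-E₀}`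
(`≥`: `λ₀ = -log ‖T₁‖ ≤ E₀` by `ofReal_le_periodicGroundStateEnergy_of_pairing_le`; `≤`: eigen-relation of
`Φ₀`), the `‖T₁‖`-eigenspace is spanned by `Φ₀` (`pfkL2_perronFrobenius` + `IsPeriodicGroundStateFK.unique`),
so `T₁` restricted to `Φ₀^⊥` has norm `e^{-(E₀+γ)} < e^{-E₀}` (second eigenvalue of a compact self-adjoint
operator; abstract lemmas of `GroundStateFeynmanKacSpectral.lean`); whence `1 - f ≤ (1-e^{-δ})/(1-e^{-γ})`;
(R2) the same for `N` bodies and `Θ₀`; (R3) a `δ`-near-minimiser `Θ` exists (`E₀ < ⊤`, definition of the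
infimum); (R4) the overlap is `L²`-Lipschitz: `|ov(f,g)| ≤ ‖f‖‖g‖` (Cauchy–Schwarz, cf.
`overlap_sq_le_one` in `Negative/InsertionResidueUniformWindowFalse`), so
`√Res ≥ √A - ‖Θ - ωΘ₀‖ - ‖Ψ - ω'Φ₀‖`.
Size L. Leans on: `PeriodicHeatFlowSpectralMeasure_holds`, `form_upper_bound_periodic`, `pfkL2`,
`isCompactOperator_pfkL2`, `isSelfAdjoint_pfkL2`, `pfkL2_perronFrobenius`, `IsPeriodicGroundStateFK.unique`,
`ofReal_le_periodicGroundStateEnergy_of_pairing_le`, `periodicGroundStateEnergy_le`, Mathlib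
`ConvexOn.map_integral_le` (Jensen). -/
theorem stub_nearMinimiserRigidity (v : ℝ → ℝ≥0∞) (hv : IsRepulsiveFiniteRange v) (N : ℕ) (L : ℝ)
    (hL : 0 < L) (hb : ∃ C : ℝ≥0, ∀ x, periodizedPotential v L x ≤ C)
    (Θ₀ : Config N → ℝ) (hΘ : IsPeriodicGroundStateFK v L Θ₀) (hΘc : Continuous Θ₀) (hΘp : ∀ X, 0 < Θ₀ X)
    (Φ₀ : Config (N + 1) → ℝ) (hΦ : IsPeriodicGroundStateFK v L Φ₀) (hΦc : Continuous Φ₀)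
    (hΦp : ∀ X, 0 < Φ₀ X) (ε : ℝ) (hε : 0 < ε) :
    ∃ δ : ℝ≥0∞, 0 < δ ∧ ∃ Θ : PeriodicTrialState N L,
      periodicEnergy v Θ ≤ periodicGroundStateEnergy v N L + δ ∧
      ∀ Ψ : PeriodicTrialState (N + 1) L,
        periodicEnergy v Ψ ≤ periodicGroundStateEnergy v (N + 1) L + δ →
        ENNReal.ofReal ((L ^ 3)⁻¹ *
            (∫ X in cellN N L, Θ₀ X * ∫ x in cell L, Φ₀ (vecCons x X)) ^ 2) ≤
          ENNReal.ofReal ((L ^ 3)⁻¹) *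
              (‖∫ X in cellN N L, conj (Θ.ψ X) * ∫ x in cell L, Ψ.ψ (vecCons x X)‖₊ : ℝ≥0∞) ^ 2 +
            ENNReal.ofReal ε := by
  sorry

/-- **Stub 4 — the static response bound in `H₋₁` currency (K1 is consumed HERE, by name;
bounded potentials).** `StaticResponseBound` (route crux 12057) gives, for every bounded repulsive
finite-range `v`, thresholds `ρ₁ > 0`, `C > 0` such that for `0 < ρ < ρ₁`, `N ≥ 1`, `L = ((N+1)/ρ)^{1/3}`
with bounded `v^per`, IF the `N`-body bath in that box has a continuous positive FK ground state `Θ₀`,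
then every density mode `g_k = Σ_j cos(p·x_j)`, `p = 2πk/L ≠ 0`, has Kipnis–Varadhan norm
`‖g_k‖²_{H₋₁(G_Θ)} = hMinusOneSqW L Θ₀ g_k ≤ C N / max(ρ' a, |p|²)`, `ρ' = N/L³ = ρN/(N+1)`.
Proof plan (v3, form-domain-free): (i) box bookkeeping `sideLength ρ' N = sideLength ρ (N+1)`,
`ρ' = ρN/(N+1) < ρ₁ := ρ₀(K1)`, so K1 reads `E₀ - C_K t² ≤ E(Ψ) + t⟨g⟩_Ψ` for all `t` and all finite-energy
periodic trial states, `C_K = C N/max(ρ'a, p²)`; (ii) mollify: `Θ_r = ρ_r ⋆ Θ₀` (`mollify` of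
`PeriodicFeynmanKacTrialState`: `C¹`, periodic, symmetric, `→ Θ₀` uniformly, kinetic energy eventually
`≤ K'` for every `K' > E₀ - ∫V^perΘ₀²` by `setLIntegral_cellN_realKinetic_mollify_le` +
`sqIncrCell_div_eventually_le` + `hΘ.eigen`), so `E(Θ_r) - E₀‖Θ_r‖² → 0`; (iii) for a symmetric periodic
`C¹` `β` and small `s` the state `(1 + sβ)Θ_r/‖·‖` is a trial state and
`E((1+sβ)Θ_r) - E₀‖(1+sβ)Θ_r‖² = a_r + 2s b_r(β) + s² c_r(β) ≥ 0` (variational principle) with `a_r → 0`,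
so the discriminant forces `b_r(β) → 0` (the weak Euler–Lagrange identity IN THE LIMIT — no form domain,
no integration by parts) and, applied to `β²`, `c_r(β) → D(β) = ∫|∇β|²Θ₀²` (ground-state representation in
the limit); (iv) K1 at coupling `t` and deformation `s = -λt`, first with `s = 0` (`∫ g Θ₀² = 0`), then
divide by `t²`, `r → 0`, `t → 0`: `2λ∫gβΘ₀² - λ²D(β) ≤ C_K`; (v) symmetrise a general test `β`
(`β_sym = (N!)⁻¹ Σ_σ β∘σ`: same pairing, smaller Dirichlet form by convexity) and conclude with
`hMinusOneSqW_le_ofReal_iff`/`le_hMinusOneSqW`. Size L. Leans on: `StaticResponseBound` (hypothesis),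
`hMinusOneSqW_le_ofReal_iff`, `dirichletFormW`, `mollify`, `mollify_periodic`,
`setLIntegral_cellN_realKinetic_mollify_le`, `abs_mollify_sub_le_of_periodic`, `sqIncrCell_div_eventually_le`,
`periodicGroundStateEnergy_le`, `kineticDensity`, Mathlib `fderiv` product rule. -/
theorem stub_responseDictionary (hK1 : StaticResponseBound) (v : ℝ → ℝ≥0∞)
    (hv : IsRepulsiveFiniteRange v) (hbdd : ∃ C : ℝ≥0, ∀ r, v r ≤ C) :
    ∃ ρ₁ : ℝ, 0 < ρ₁ ∧ ∃ C : ℝ, 0 < C ∧ ∀ ρ : ℝ, 0 < ρ → ρ < ρ₁ → ∀ N : ℕ, 1 ≤ N →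
      (∃ C' : ℝ≥0, ∀ x, periodizedPotential v (sideLength ρ (N + 1)) x ≤ C') →
      IsPeriodicGroundStateFK v (sideLength ρ (N + 1))
          (periodicFKGroundState v N (sideLength ρ (N + 1))) →
      Continuous (periodicFKGroundState v N (sideLength ρ (N + 1))) →
      (∀ X, 0 < periodicFKGroundState v N (sideLength ρ (N + 1)) X) →
      ∀ k : Fin 3 → ℤ, k ≠ 0 →
        hMinusOneSqW (sideLength ρ (N + 1)) (periodicFKGroundState v N (sideLength ρ (N + 1)))
            (fun X : Config N =>
              ∑ j, Real.cos (2 * Real.pi / sideLength ρ (N + 1) * ∑ i, (k i : ℝ) * X j i)) ≤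
          ENNReal.ofReal (C * N /
            max (N / sideLength ρ (N + 1) ^ 3 * (scatteringLength v).toReal)
              ((2 * Real.pi / sideLength ρ (N + 1)) ^ 2 * ∑ i, (k i : ℝ) ^ 2)) := by
  sorry

/-- **Stub 5 — the recoil lemma (first brick of the first-corrector bound).**
In the weighted-corrector vocabulary of `WeightedCorrector.lean` (weight `Θ` on the `M`-particle torus of
side `L`, Dirichlet form `𝓔_Θ = dirichletFormW L Θ`, Kipnis–Varadhan norm `hMinusOneSqW L Θ`): if a periodic
test function `ξ` solves the MASSIVE corrector equation `(-G_Θ + q) ξ = a` weakly, i.e.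
`𝓔_Θ(ξ, φ) + q ∫ ξ φ Θ² = ∫ a φ Θ²` for every periodic test `φ`, with mass `q > 0` (in the line: `q = |p|²`,
the recoil of the tagged particle in the `y`-mode `p`; `-G_Θ - Δ_y` acts on `e^{ip·y}ξ(X')` as
`e^{ip·y}(-G_Θ + |p|²)ξ`), then `4 q ∫ ξ² Θ² ≤ ‖a‖²_{H₋₁(G_Θ)}` — the operator inequality
`(ω + q)⁻² ≤ (4ωq)⁻¹` that makes the first Kac corrector `L²`-bounded uniformly in `L` in `d = 3`
(`‖χ₁‖² ≤ ¼ Σ_p ‖Û_p‖²_{H₋₁(G_Θ)}/|p|²`). Proof: test `hMinusOneSqW` against `λ ξ`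
(`le_hMinusOneSqW`): with `e = 𝓔_Θ(ξ,ξ) ≥ 0`, `Q = ∫ξ²Θ² ≥ 0` and `P = ∫aξΘ² = e + qQ` (the equation at
`φ = ξ`), `‖a‖²₋₁ ≥ 2λP - λ²e` for all `λ`; if `e > 0` take `λ = P/e`: `P²/e = (e + qQ)²/e ≥ 4qQ`; if
`e = 0` then `2λqQ ≤ ‖a‖²₋₁` for all `λ`, so `Q = 0` or `‖a‖²₋₁ = ⊤`. No side condition on `Θ`, `a`, `L`
is needed (junk integrals are harmless: the equation hands over the value of `P`). Size S.
Leans on: `le_hMinusOneSqW`, `IsPeriodicTest.smul`, `dirichletFormW_smul_left/right`,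
`dirichletFormW_self_nonneg`, `integral_mul_smul_mul_sq`. -/
theorem stub_firstCorrector :
    ∀ (M : ℕ) (L : ℝ) (Θ : Config M → ℝ) (q : ℝ), 0 < q → ∀ (a ξ : Config M → ℝ),
      IsPeriodicTest L ξ →
      (∀ φ : Config M → ℝ, IsPeriodicTest L φ →
        dirichletFormW L Θ ξ φ + q * ∫ X in cellN M L, ξ X * φ X * Θ X ^ 2 =
          ∫ X in cellN M L, a X * φ X * Θ X ^ 2) →
      ENNReal.ofReal (4 * q * ∫ X in cellN M L, ξ X ^ 2 * Θ X ^ 2) ≤ hMinusOneSqW L Θ a := by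
  sorry

/-- **Stub 6 — Kac closure (HARDEST, held by the lead): static response in `H₋₁` currency + recoil ⇒
the mollified residue of the TRUE ground states is bounded below (bounded potentials).**
For every bounded repulsive finite-range `v` and every response constant `C > 0` there are `ρ₃ > 0`
and `cK > 0` such that for `0 < ρ < ρ₃` and all large `N` (`L = ((N+1)/ρ)^{1/3}`): if `v^per` is bounded
in the box, the FK ground states `Θ₀` (`N` bodies), `Φ₀` (`N+1` bodies) exist, are continuous and
positive, the bath density modes obey `‖Σ_j cos(p·x_j)‖²_{H₋₁(G_Θ)} ≤ C N/max(ρ'a, p²)` for all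
`p ∈ (2π/L)ℤ³∖0` (Stub 4's output, verbatim) and the recoil lemma holds (Stub 5's statement, verbatim),
then `cK · B ≤ A`: the MOLLIFIED residue `Z_T = A/B = (E h_T)²/E h_T² ≥ cK`
(`E f = L⁻³∫ f Θ₀(X')² dX' dy`, `h_T = e^{TΔ_y}(Φ₀/Θ₀)`, `T = (N+1)/(16E₀(N+1,L)) ≳ ξ²` by the proved
`LSSY2005_upperBound_periodic_holds`; `1/Z_T - 1 = Var(h_T)/(E h_T)²`).
Mechanism (the route's Kipnis–Varadhan engine run for the Kac insertion operator `K₀ + U_T`,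
`K₀ = -G_Θ - Δ_y`, `U_T = 8πa Σ_j G^per_T(y - x_j)`): internal step (a) the DRESSED-CHARGE / marks lemma
(v2 `stub_dressedCharge`, triage r1-1/2/3 sharpening; kept here as the typed sub-claim a disprover may
attack): with `μ = E₀(N+1) - E₀(N)`, the mark functional
`ℓ(φ) = μ∫h_Tφ F² - 𝓔_F(h_T,φ) - ∫U_T h_T φ F²` (`F = Θ₀∘vecTail`; weakly `= ∫((Wh)_T - U_T h_T)φF²` by
`(K₀ - μ)h_T = -(Wh)_T`), centred `ℓ̃(φ) = ℓ(φ) - ℓ(1)·Eφ`, has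
`‖ℓ̃‖²_{H₋₁(K₀)} ≤ η²(E h_T)²‖U_T - EU_T‖²_{H₋₁(K₀)}` with `η = O(√(ρa³))` (local pair factorisation
`h = f(·-x_j)g_j`, `∫vf = 8πa`, screened dressing); (b) `‖U_T - EU_T‖²_{H₋₁(K₀)} ≤ Σ_{p≠0}(L³/2)
(‖a_p‖² + ‖b_p‖²)_{H₋₁(G_Θ)}` (orthogonality of the `y`-modes; `U_T` has `y`-coefficients
`8πa L⁻³e^{-T|p|²}Σ_j e^{-ip·x_j}` by Poisson summation of the periodised Gaussian, coordinatewise) and the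
hypothesis mode by mode (sine modes by translation invariance of `Θ₀`) give
`E|∇χ₁|² = O(μ√(ρa³))`; (c) the recoil lemma per mode gives `‖χ₁‖²_{L²} ≤ ¼Σ_p‖Û_p‖²₋₁/|p|² = O(√(ρa³))`;
(d) higher correctors carry `e^{-T|p|²}` at every vertex; `‖χ_T‖² ≤ C'`, `cK = 1/(1+C')`.
Why it might fail (the crux's residual, untouched by the lever — card, triage, Disproof §13): `A ≤ f₀(Φ₀)`
(condensate fraction, Disproof §5), so the conclusion CONTAINS torus BEC of the FK ground states; the
two-mode source `|∇χ₁|² - E|∇χ₁|²` at `|p| → 0` needs 4-point control of the bath not implied by the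
2-point `H₋₁` hypothesis; the Kac operator is gapless above its ground state (`μ ≫ (2π/L)²`), so
"approximate eigenfunction ⇒ close to eigenfunction" must itself be an `H₋₁` argument; existence of weak
correctors (Lax–Milgram in the weighted `H¹` of the torus) is not in the tree. The statement is about the
TRUE ground states (any further true property of `Θ₀`, `Φ₀` may be used); if torus BEC holds at low
density the conclusion is true outright. Size XL. Leans on: `hMinusOneSqW`, `IsWeakCorrector`
(`.hMinusOneSqW_eq`, `.sq_integral_le`), `dirichletFormW`, `langevinGen`, `integral_mul_langevinGen_mul_sq`,
`cellFourierCoeff`/`configFourierCoeff` Parseval layers, `IsPeriodicGroundStateFK`,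
`LSSY2005_upperBound_periodic_holds`, `LSSY2005_lowerBound_periodic_holds`; KipnisVaradhan1986 Thm 1.8 /
Cor. 1.9, KipnisLandim1999 App. 1 §6, ReattoChester1967, LSSY2005 Lemma 2.5 (Dyson), GuentherEtAl2021 (10). -/
theorem stub_kacClosure (v : ℝ → ℝ≥0∞) (hv : IsRepulsiveFiniteRange v) (hbdd : ∃ C : ℝ≥0, ∀ r, v r ≤ C)
    (C : ℝ) (hC : 0 < C) :
    ∃ ρ₃ : ℝ, 0 < ρ₃ ∧ ∃ cK : ℝ, 0 < cK ∧ ∀ ρ : ℝ, 0 < ρ → ρ < ρ₃ → ∀ᶠ N : ℕ in atTop,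
      (∃ C' : ℝ≥0, ∀ x, periodizedPotential v (sideLength ρ (N + 1)) x ≤ C') →
      IsPeriodicGroundStateFK v (sideLength ρ (N + 1))
          (periodicFKGroundState v N (sideLength ρ (N + 1))) →
      Continuous (periodicFKGroundState v N (sideLength ρ (N + 1))) →
      (∀ X, 0 < periodicFKGroundState v N (sideLength ρ (N + 1)) X) →
      IsPeriodicGroundStateFK v (sideLength ρ (N + 1))
          (periodicFKGroundState v (N + 1) (sideLength ρ (N + 1))) →
      Continuous (periodicFKGroundState v (N + 1) (sideLength ρ (N + 1))) →
      (∀ X, 0 < periodicFKGroundState v (N + 1) (sideLength ρ (N + 1)) X) →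
      (∀ k : Fin 3 → ℤ, k ≠ 0 →
        hMinusOneSqW (sideLength ρ (N + 1)) (periodicFKGroundState v N (sideLength ρ (N + 1)))
            (fun X : Config N =>
              ∑ j, Real.cos (2 * Real.pi / sideLength ρ (N + 1) * ∑ i, (k i : ℝ) * X j i)) ≤
          ENNReal.ofReal (C * N /
            max (N / sideLength ρ (N + 1) ^ 3 * (scatteringLength v).toReal)
              ((2 * Real.pi / sideLength ρ (N + 1)) ^ 2 * ∑ i, (k i : ℝ) ^ 2))) →
      (∀ (M : ℕ) (L : ℝ) (Θ : Config M → ℝ) (q : ℝ), 0 < q → ∀ (a ξ : Config M → ℝ),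
        IsPeriodicTest L ξ →
        (∀ φ : Config M → ℝ, IsPeriodicTest L φ →
          dirichletFormW L Θ ξ φ + q * ∫ X in cellN M L, ξ X * φ X * Θ X ^ 2 =
            ∫ X in cellN M L, a X * φ X * Θ X ^ 2) →
        ENNReal.ofReal (4 * q * ∫ X in cellN M L, ξ X ^ 2 * Θ X ^ 2) ≤ hMinusOneSqW L Θ a) →
      ENNReal.ofReal cK *
          ∫⁻ X in cellN (N + 1) (sideLength ρ (N + 1)), ENNReal.ofReal
            ((let T : ℝ := ((N : ℝ) + 1) /
                (16 * (periodicGroundStateEnergy v (N + 1) (sideLength ρ (N + 1))).toReal)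
              if T ≤ 0 then periodicFKGroundState v (N + 1) (sideLength ρ (N + 1)) X
              else ∫ z : Space, ((4 * Real.pi * T) ^ (3 / 2 : ℝ))⁻¹ * Real.exp (-‖z‖ ^ 2 / (4 * T)) *
                periodicFKGroundState v (N + 1) (sideLength ρ (N + 1)) (vecCons (X 0 - z) (vecTail X))) ^ 2) ≤
        ENNReal.ofReal ((sideLength ρ (N + 1) ^ 3)⁻¹ *
          (∫ X in cellN N (sideLength ρ (N + 1)),
            periodicFKGroundState v N (sideLength ρ (N + 1)) X *
              ∫ x in cell (sideLength ρ (N + 1)),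
                periodicFKGroundState v (N + 1) (sideLength ρ (N + 1)) (vecCons x X)) ^ 2) := by
  sorry

/-- **Stub 7 — the unbounded (hard / singular core) case: the crux itself for unbounded admissible
potentials (UNDELEGATED; the honest hole of this line).** For an admissible `v` that is NOT bounded
(hard cores `v = ⊤` on a set of radii, or finite but unbounded cores) the FK chain of Stubs 2–6 has no
input: the tree's torus Feynman–Kac theory (existence, continuity, positivity, small-time form bounds,
compactness, Perron–Frobenius, spectral measure) is stated and proved for BOUNDED periodised potentials
only (`PeriodicHeatFlowSpectral.lean`, "What is NOT here: hard cores"). What a proof would need: EITHER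
(i) the hard-core FK frame — connectivity of the dilute free region `{|xᵢ-xⱼ|_𝕋 > R₀}` (true once
`ρR₀³ ≪ 1`), positivity improving of the killed semigroup on it, `E₀^per < ⊤` eventually (Ruelle,
`exists_eventually_periodicGroundStateEnergy_lt_top`), and small-time form bounds for `C¹` states vanishing
on the cores (hitting estimates `O(t^{3/2})`) — and then the same chain verbatim; OR (ii) a truncation
`v_n = min(v, n) ↑ v` with the bounded-case constants `(ρ₀, c)` UNIFORM in `n` (not extractable from the
`∃`-statements of Stubs 2–6) plus monotone convergence of `E₀^per(v_n) ↑ E₀^per(v)` at fixed `N, L`.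
This statement is crux-sized by construction (it is `StaticResponseBound →` the body of `InsertionResidue`
for unbounded `v`); it is registered so that the composition is honest and the hole is attackable by name;
the lead flags it as the `promote-stub` candidate. Diluteness (Disproof §10: hard spheres jam at `ρ = 64`)
is respected: `∃ ρ₀ > 0`. Size XL (open). Leans on: nothing in the tree beyond the bounded chain. -/
theorem stub_unboundedCase (hK1 : StaticResponseBound) (v : ℝ → ℝ≥0∞) (hv : IsRepulsiveFiniteRange v)
    (hub : ¬ ∃ C : ℝ≥0, ∀ r, v r ≤ C) :
    ∃ ρ₀ : ℝ, 0 < ρ₀ ∧ ∀ ρ : ℝ, 0 < ρ → ρ < ρ₀ → ∃ c : ℝ, 0 < c ∧ ∀ᶠ N : ℕ in Filter.atTop,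
      ∃ δ : ENNReal, 0 < δ ∧ ∃ Θ : PeriodicTrialState N (sideLength ρ (N + 1)),
        periodicEnergy v Θ ≤ periodicGroundStateEnergy v N (sideLength ρ (N + 1)) + δ ∧
        ∀ Ψ : PeriodicTrialState (N + 1) (sideLength ρ (N + 1)),
          periodicEnergy v Ψ ≤ periodicGroundStateEnergy v (N + 1) (sideLength ρ (N + 1)) + δ →
          ENNReal.ofReal c ≤ ENNReal.ofReal ((sideLength ρ (N + 1) ^ 3)⁻¹) *
            (‖∫ X in cellN N (sideLength ρ (N + 1)), conj (Θ.ψ X) *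
                ∫ x in cell (sideLength ρ (N + 1)), Ψ.ψ (vecCons x X)‖₊ : ℝ≥0∞) ^ 2 := by
  sorry

/-! ## Glue (sorry-free) -/

/-- `c + c ≤ R + c` in `ℝ≥0∞` with `c` finite forces `c ≤ R`. [folklore] -/
theorem le_of_add_self_le_add {c R : ℝ≥0∞} (hc : c ≠ ⊤) (h : c + c ≤ R + c) : c ≤ R :=
  (ENNReal.add_le_add_iff_right hc).1 h

/-- **The composition** (concludes the crux BY NAME). Unbounded `v`: Stub 7. Bounded `v`:
`StaticResponseBound` enters Stub 4; Stubs 2, 4, 6 give thresholds in `ρ` and eventualities in `N`; for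
such `N`: `cK · (9/16) ≤ cK · B ≤ A ≤ Res(Θ,Ψ) + cK·(9/32)` in `ℝ≥0∞`, whence `Res(Θ,Ψ) ≥ c := cK · 9/32`. -/
theorem CorrectorClosure_of : CorrectorClosure := by
  intro hK1 v hv
  by_cases hbdd : ∃ C : ℝ≥0, ∀ r, v r ≤ C
  swap
  · exact stub_unboundedCase hK1 v hv hbdd
  obtain ⟨ρA, hρA, hGS⟩ := stub_groundStateExists v hv hbdd
  obtain ⟨ρ₁, hρ₁, C, hC, hDict⟩ := stub_responseDictionary hK1 v hv hbdd
  obtain ⟨ρ₃, hρ₃, cK, hcK, hKac⟩ := stub_kacClosure v hv hbdd C hC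
  refine ⟨min ρA (min ρ₁ ρ₃), by positivity, fun ρ hρ hρlt => ?_⟩
  have hρA' : ρ < ρA := lt_of_lt_of_le hρlt (min_le_left _ _)
  have hρ₁' : ρ < ρ₁ := lt_of_lt_of_le hρlt ((min_le_right _ _).trans (min_le_left _ _))
  have hρ₃' : ρ < ρ₃ := lt_of_lt_of_le hρlt ((min_le_right _ _).trans (min_le_right _ _))
  set c : ℝ := cK * (9 / 16) / 2 with hc_def
  have hc : 0 < c := by positivity
  refine ⟨c, hc, ?_⟩
  filter_upwards [hGS ρ hρ hρA', hKac ρ hρ hρ₃', eventually_ge_atTop 1] with N hGSN hKacN hN1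
  obtain ⟨hb, ⟨hΘ, hΘc, hΘp⟩, ⟨hΦ, hΦc, hΦp⟩⟩ := hGSN
  have hL : 0 < sideLength ρ (N + 1) := sideLength_succ_pos hρ N
  -- Stub 4: K1 in H₋₁ currency for the bath ground state
  have hDictN := hDict ρ hρ hρ₁' N hN1 hb hΘ hΘc hΘp
  -- Stub 6: the Kac closure, `cK · B ≤ A`, fed with Stub 4's output and Stub 5 (recoil lemma)
  have hKacN' := hKacN hb hΘ hΘc hΘp hΦ hΦc hΦp hDictN stub_firstCorrector
  -- Stub 1: `9/16 ≤ B`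
  have hUV := stub_uvTransfer v hv.1 N (sideLength ρ (N + 1)) hL hΦ
  -- hence `cK · 9/16 ≤ A`
  have hA : ENNReal.ofReal (c + c) ≤
      ENNReal.ofReal ((sideLength ρ (N + 1) ^ 3)⁻¹ *
        (∫ X in cellN N (sideLength ρ (N + 1)),
          periodicFKGroundState v N (sideLength ρ (N + 1)) X *
            ∫ x in cell (sideLength ρ (N + 1)),
              periodicFKGroundState v (N + 1) (sideLength ρ (N + 1)) (vecCons x X)) ^ 2) := by
    have hcc : c + c = cK * (9 / 16) := by rw [hc_def]; ring
    rw [hcc, ENNReal.ofReal_mul hcK.le]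
    exact (mul_le_mul' le_rfl hUV).trans hKacN'
  -- Stub 3: transfer to the near-minimiser frame with `ε = c`
  obtain ⟨δ, hδ, Θ, hΘE, hΨ⟩ := stub_nearMinimiserRigidity v hv N (sideLength ρ (N + 1)) hL hb
    _ hΘ hΘc hΘp _ hΦ hΦc hΦp c hc
  refine ⟨δ, hδ, Θ, hΘE, fun Ψ hΨE => ?_⟩
  have h2 := hA.trans (hΨ Ψ hΨE)
  rw [ENNReal.ofReal_add hc.le hc.le] at h2
  exact le_of_add_self_le_add ENNReal.ofReal_ne_top h2

end Summit.AtomisticToContinuum.BoseEinsteinCondensation.Cruxes.CorrectorClosure.HealingScaleKacInsertion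

end
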